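import Mathlib
import Summits.Ventures.PercRepro2.Defs
import Summits.Ventures.PercRepro2.Graph
import Summits.Ventures.PercRepro2.OneColourSwitch
import Summits.Ventures.PercRepro2.RegionHubSign
import Summits.Ventures.PercRepro2.SideSwitch
import Summits.Ventures.PercRepro2.SideSwitchComps
import Summits.Ventures.PercRepro2.TermSwitchDefs
import Summits.Ventures.PercRepro2.TermSwitchFibre
import Summits.Ventures.PercRepro2.TermSwitchCompsFibre
import Summits.Ventures.PercRepro2.TermSwitchMono
import Summits.Ventures.PercRepro2.TermSwitchM9
import Summits.Ventures.PercRepro2.M9NoPocketDefs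
import Summits.Ventures.PercRepro2.M9YSliceDefs
import Summits.Ventures.PercRepro2.M9YSliceOD

/-!
# The unreached half of the `Y`-slice along the fibres of `G − d` (blind cell PercRepro2,
p3 g26, 2026-08-28; `proofs/P3-YSLICE.md` §3(O), part 2)

In the `{r, s}`-fibration of the looped graph `G − d` (`endsD`) the vertex `d` is never sided
(`d_not_mem_A0H_endsD`), so a component assignment never touches the edges at `d`
(`assignC_endsD_at_d`) and the slice predicate `StarY` is constant along a fibre
(`starY_assignC_endsD`); the predicate `NoNbK` («no neighbour of `d` in the `Y`-world of
`G − d`») holds at the assignment `T` exactly when no neighbour of `d` is a terminal and every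
component holding a neighbour of `d` (`nbComps`) lies in `T` (`noNbK_assignC_iff`,
`oker_assignC`).  The pairing partner of a slice representative is its outside flip with the
star forced back to `Y` (`starForce`, `phiO`): an involution of the slice representatives
(`phiO_phiO`, `phiO_mem_RepH`) that keeps the components (`compsH_phiO`, `nbComps_phiO`) and
agrees with the plain outside flip off the edges at `d` (`assignC_phiO_eq_off`), so that the
lane's complement identity reads `p ~_W q` at `ρ_T` in `G − d` ⟺ `p ~_Y q` at `(φρ)_{A ∖ T}`
(`conn_pq_compl_assignC_phiO`).  Own work; std axioms.
-/

namespace Summit.Ventures.PercRepro2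

namespace NoPocket

open Finset Classical RegionHub OneColourSwitch SideSwitch TermSwitch

variable {V : Type*} {E : Type*}
variable [Fintype V] [DecidableEq V] [Fintype E] [DecidableEq E]

section Fibre

variable {ends : E → Sym2 V}

omit [DecidableEq V] [Fintype E] [DecidableEq E] in
/-- `d` is never sided in `G − d`. -/
lemma d_not_mem_A0H_endsD {r s d : V} (hr : d ≠ r) (hs : d ≠ s) (ω : Config E) :
    d ∉ A0H (endsD ends d) ({r, s} : Set V) ω := by
  intro h
  obtain ⟨hU, _⟩ := mem_A0H.1 h
  rcases hU with hK | hM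
  · exact not_mem_K2_endsD hr hs ω hK
  · exact not_mem_M2_endsD hr hs ω hM

omit [Fintype E] [DecidableEq E] in
/-- A component assignment of `G − d` never touches an edge at `d`. -/
lemma assignC_endsD_at_d {r s d : V} (hr : d ≠ r) (hs : d ≠ s) {ρ : Config E}
    {T : Finset (Finset V)} (hT : T ⊆ compsH (endsD ends d) ({r, s} : Set V) ρ) {e : E}
    (hde : d ∈ ends e) : assignC (endsD ends d) T ρ e = ρ e := by
  simp only [assignC, assign]
  refine flipTouch_of_notMem _ ?_
  rintro ⟨x, hx, y, hxy⟩
  rw [endsD_of_mem hde, Sym2.eq_iff] at hxy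
  have hxd : x = d := by
    rcases hxy with ⟨h, _⟩ | ⟨_, h⟩ <;> exact h.symm
  subst hxd
  exact d_not_mem_A0H_endsD hr hs ρ (unionT_subset_A0H hT (Finset.mem_coe.1 hx))

omit [Fintype E] [DecidableEq E] in
/-- The slice predicate is constant along the fibres of `G − d`. -/
lemma starY_assignC_endsD {r s d : V} (hr : d ≠ r) (hs : d ≠ s) {ρ : Config E}
    {T : Finset (Finset V)} (hT : T ⊆ compsH (endsD ends d) ({r, s} : Set V) ρ) :
    StarY ends d (assignC (endsD ends d) T ρ) ↔ StarY ends d ρ := by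
  unfold StarY
  constructor
  · intro h e hde hnd
    rw [← assignC_endsD_at_d hr hs hT hde]
    exact h e hde hnd
  · intro h e hde hnd
    rw [assignC_endsD_at_d hr hs hT hde]
    exact h e hde hnd

variable (ends)

/-- The components of `G − d` holding a neighbour of `d`. -/
noncomputable def nbComps (r s d : V) (ρ : Config E) : Finset (Finset V) :=
  (compsH (endsD ends d) ({r, s} : Set V) ρ).filter (fun C => ∃ e y, ends e = s(d, y) ∧ y ∈ C)

omit [Fintype V] [DecidableEq V] [Fintype E] [DecidableEq E] in
/-- No neighbour of `d` is a terminal. -/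
def NoNbH (r s d : V) : Prop := ∀ e y, ends e = s(d, y) → y ∉ ({r, s} : Set V)

variable {ends}

omit [Fintype V] [DecidableEq V] [Fintype E] [DecidableEq E] in
/-- The `Y`-world of `{r, s}` in `G − d`, as a terminal-set world. -/
lemma K2_eq_KH_endsD (r s d : V) (ω : Config E) :
    K2 (endsD ends d) r s ω = KH (endsD ends d) ({r, s} : Set V) ω := rfl

/-- **The predicate `NoNbK` along a fibre**: at the assignment `T` it says that no neighbour of
`d` is a terminal and every component holding a neighbour of `d` is in `T`. -/
lemma noNbK_assignC_iff {p q r s d : V} {ρ : Config E}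
    (hρ : ρ ∈ RepH (endsD ends d) p q ({r, s} : Set V)) {T : Finset (Finset V)}
    (hT : T ⊆ compsH (endsD ends d) ({r, s} : Set V) ρ) :
    NoNbK ends r s d (assignC (endsD ends d) T ρ) ↔
      (NoNbH ends r s d ∧ nbComps ends r s d ρ ⊆ T) := by
  constructor
  · intro h
    refine ⟨?_, ?_⟩
    · intro e y hey hyH
      exact h e y hey (by rw [K2_eq_KH_endsD]; exact mem_KH_of_mem hyH _)
    · intro C hC
      obtain ⟨hCc, e, y, hey, hyC⟩ := Finset.mem_filter.1 hC
      have hyA : y ∈ A0H (endsD ends d) ({r, s} : Set V) ρ := subset_A0H_of_mem_compsH hCc hyC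
      by_contra hCT
      have hyU : y ∉ unionT T := by
        intro hyU
        obtain ⟨C', hC', hyC'⟩ := mem_unionT.1 hyU
        have e1 := eq_compIn_of_mem_compsH (hT hC') hyC'
        have e2 := eq_compIn_of_mem_compsH hCc hyC
        rw [e1, ← e2] at hC'
        exact hCT hC'
      have hy' : y ∈ unionT (compsH (endsD ends d) ({r, s} : Set V) ρ) \ unionT T := by
        rw [unionT_compsH]; exact Finset.mem_sdiff.2 ⟨hyA, hyU⟩
      have hyK : y ∈ KH (endsD ends d) ({r, s} : Set V) (assignC (endsD ends d) T ρ) :=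
        (sideC_of_mem_sdiff_H hρ hT (Finset.Subset.refl _) hy').1
      exact h e y hey (by rw [K2_eq_KH_endsD]; exact hyK)
  · rintro ⟨hH, hN⟩ e y hey hyK
    rw [K2_eq_KH_endsD] at hyK
    rcases vertex_cases_H (ends := endsD ends d) (H := ({r, s} : Set V)) ρ y with hyH | hyA | hyO
    · exact hH e y hey hyH
    · have hC : compIn (endsD ends d) (↑(A0H (endsD ends d) ({r, s} : Set V) ρ) : Set V) y ∈
          nbComps ends r s d ρ :=
        Finset.mem_filter.2 ⟨Finset.mem_image.2 ⟨y, hyA, rfl⟩, e, y, hey, mem_compIn_self _ _⟩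
      have hyU : y ∈ unionT T := mem_unionT.2 ⟨_, hN hC, mem_compIn_self _ _⟩
      exact (sideC_of_mem_H hρ hT hyU).1 hyK
    · have hyO' : y ∈ OsetH (endsD ends d) ({r, s} : Set V) (assignC (endsD ends d) T ρ) := by
        rw [OsetH_assignC hT]; exact hyO
      exact hyO' (Or.inl hyK)

/-- **The kernel along a fibre.** -/
lemma oker_assignC {p q r s d : V} (hr : d ≠ r) (hs : d ≠ s) {ρ : Config E}
    (hρ : ρ ∈ RepH (endsD ends d) p q ({r, s} : Set V)) {T : Finset (Finset V)}
    (hT : T ⊆ compsH (endsD ends d) ({r, s} : Set V) ρ) :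
    oker ends p q r s d (assignC (endsD ends d) T ρ) =
      if StarY ends d ρ ∧ NoNbH ends r s d ∧ nbComps ends r s d ρ ⊆ T then
        ((if Conn ends (assignC (endsD ends d) T ρ) p q then (1 : ℤ) else 0) -
          (if Conn (endsD ends d) (OneColourSwitch.compl (assignC (endsD ends d) T ρ)) p q
            then 1 else 0)) * sigma (endsD ends d) (assignC (endsD ends d) T ρ) r s
      else 0 := by
  unfold oker
  have h : (StarY ends d (assignC (endsD ends d) T ρ) ∧
      NoNbK ends r s d (assignC (endsD ends d) T ρ)) ↔
      (StarY ends d ρ ∧ NoNbH ends r s d ∧ nbComps ends r s d ρ ⊆ T) := by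
    rw [starY_assignC_endsD hr hs hT, noNbK_assignC_iff hρ hT]
  rw [if_congr h rfl rfl]

end Fibre

section Involution

variable (ends : E → Sym2 V)

omit [Fintype V] [Fintype E] [DecidableEq E] in
/-- Force every non-loop edge at `d` to `Y`. -/
def starForce (d : V) (ω : Config E) : Config E :=
  fun e => if d ∈ ends e ∧ ¬ (ends e).IsDiag then true else ω e

/-- The pairing partner of a slice representative: the outside flip of `G − d`, with the star of
`d` forced back to `Y`. -/
noncomputable def phiO (r s d : V) (ρ : Config E) : Config E :=
  starForce ends d (flipOH (endsD ends d) ({r, s} : Set V) ρ)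

variable {ends}

omit [Fintype V] [Fintype E] [DecidableEq E] in
/-- `starForce` changes nothing off the edges at `d`. -/
lemma starForce_of_not_mem {d : V} {ω : Config E} {e : E} (he : d ∉ ends e) :
    starForce ends d ω e = ω e := by
  simp [starForce, he]

omit [Fintype V] [Fintype E] [DecidableEq E] in
/-- `starForce` changes nothing on a loop. -/
lemma starForce_of_isDiag {d : V} {ω : Config E} {e : E} (he : (ends e).IsDiag) :
    starForce ends d ω e = ω e := by
  simp [starForce, he]

omit [Fintype V] [Fintype E] [DecidableEq E] in
/-- `starForce` produces a slice colouring. -/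
lemma starY_starForce (d : V) (ω : Config E) : StarY ends d (starForce ends d ω) := by
  intro e hde hnd
  simp [starForce, hde, hnd]

omit [Fintype V] [Fintype E] [DecidableEq E] in
/-- `starForce` fixes the slice colourings. -/
lemma starForce_of_starY {d : V} {ω : Config E} (h : StarY ends d ω) :
    starForce ends d ω = ω := by
  funext e
  by_cases hde : d ∈ ends e
  · by_cases hnd : (ends e).IsDiag
    · exact starForce_of_isDiag hnd
    · simp [starForce, hde, hnd, h e hde hnd]
  · exact starForce_of_not_mem hde

omit [Fintype V] [Fintype E] [DecidableEq E] in
/-- The worlds of `G − d` do not see `starForce`. -/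
lemma KH_endsD_starForce (r s d : V) (ω : Config E) :
    KH (endsD ends d) ({r, s} : Set V) (starForce ends d ω) =
      KH (endsD ends d) ({r, s} : Set V) ω := by
  rw [← K2_eq_KH_endsD, ← K2_eq_KH_endsD]
  exact K2_endsD_eq_of_eqOn (fun e he => starForce_of_not_mem he) r s

omit [Fintype V] [Fintype E] [DecidableEq E] in
/-- The `W`-worlds of `G − d` do not see `starForce`. -/
lemma MH_endsD_starForce (r s d : V) (ω : Config E) :
    MH (endsD ends d) ({r, s} : Set V) (starForce ends d ω) =
      MH (endsD ends d) ({r, s} : Set V) ω := by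
  show M2 (endsD ends d) r s (starForce ends d ω) = M2 (endsD ends d) r s ω
  exact M2_endsD_eq_of_eqOn (fun e he => starForce_of_not_mem he) r s

omit [Fintype E] [DecidableEq E] in
/-- The sided set of `G − d` does not see `starForce`. -/
lemma A0H_endsD_starForce (r s d : V) (ω : Config E) :
    A0H (endsD ends d) ({r, s} : Set V) (starForce ends d ω) =
      A0H (endsD ends d) ({r, s} : Set V) ω := by
  ext x
  simp only [mem_A0H, KH_endsD_starForce, MH_endsD_starForce]

omit [Fintype E] [DecidableEq E] in
/-- The components of `G − d` do not see `starForce`. -/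
lemma compsH_endsD_starForce (r s d : V) (ω : Config E) :
    compsH (endsD ends d) ({r, s} : Set V) (starForce ends d ω) =
      compsH (endsD ends d) ({r, s} : Set V) ω := by
  simp only [compsH, A0H_endsD_starForce]

omit [Fintype V] [Fintype E] [DecidableEq E] in
/-- The outside of `G − d` does not see `starForce`. -/
lemma OsetH_endsD_starForce (r s d : V) (ω : Config E) :
    OsetH (endsD ends d) ({r, s} : Set V) (starForce ends d ω) =
      OsetH (endsD ends d) ({r, s} : Set V) ω := by
  simp only [OsetH, KH_endsD_starForce, MH_endsD_starForce]

/-- `starForce` preserves the representatives of `G − d`. -/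
lemma starForce_mem_RepH {p q r s d : V} {ω : Config E}
    (h : ω ∈ RepH (endsD ends d) p q ({r, s} : Set V)) :
    starForce ends d ω ∈ RepH (endsD ends d) p q ({r, s} : Set V) := by
  rw [mem_RepH] at h ⊢
  rw [sepH, KH_endsD_starForce, MH_endsD_starForce]
  exact h

/-- `phiO` preserves the representatives of `G − d`. -/
lemma phiO_mem_RepH {p q r s d : V} {ρ : Config E}
    (h : ρ ∈ RepH (endsD ends d) p q ({r, s} : Set V)) :
    phiO ends r s d ρ ∈ RepH (endsD ends d) p q ({r, s} : Set V) :=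
  starForce_mem_RepH (flipOH_mem_RepH h)

omit [Fintype V] [Fintype E] [DecidableEq E] in
/-- `phiO` produces a slice colouring. -/
lemma starY_phiO (r s d : V) (ρ : Config E) : StarY ends d (phiO ends r s d ρ) :=
  starY_starForce d _

omit [Fintype E] [DecidableEq E] in
/-- `phiO` keeps the components of `G − d`. -/
lemma compsH_phiO (r s d : V) (ρ : Config E) :
    compsH (endsD ends d) ({r, s} : Set V) (phiO ends r s d ρ) =
      compsH (endsD ends d) ({r, s} : Set V) ρ := by
  unfold phiO
  rw [compsH_endsD_starForce, compsH_flipOH]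

omit [DecidableEq E] in
/-- `phiO` keeps the components holding a neighbour of `d`. -/
lemma nbComps_phiO (r s d : V) (ρ : Config E) :
    nbComps ends r s d (phiO ends r s d ρ) = nbComps ends r s d ρ := by
  simp only [nbComps, compsH_phiO]

omit [Fintype V] [Fintype E] [DecidableEq E] in
/-- `phiO` agrees with the outside flip off the edges at `d`. -/
lemma phiO_eq_off {r s d : V} {ρ : Config E} {e : E} (he : d ∉ ends e) :
    phiO ends r s d ρ e = flipOH (endsD ends d) ({r, s} : Set V) ρ e :=
  starForce_of_not_mem he

omit [Fintype V] [Fintype E] [DecidableEq E] in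
/-- The outside of `G − d` does not see `phiO`. -/
lemma OsetH_phiO (r s d : V) (ρ : Config E) :
    OsetH (endsD ends d) ({r, s} : Set V) (phiO ends r s d ρ) =
      OsetH (endsD ends d) ({r, s} : Set V) ρ := by
  unfold phiO
  rw [OsetH_endsD_starForce, flipOH, OsetH_flipIn]

omit [Fintype V] [Fintype E] [DecidableEq E] in
/-- The outside flip applied to `phiO ρ` undoes the outside flip inside `phiO ρ`, edge by edge
(off the forced star). -/
lemma flipIn_phiO_eq {r s d : V} {ρ : Config E} {e : E}
    (h2 : phiO ends r s d ρ e = flipOH (endsD ends d) ({r, s} : Set V) ρ e) :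
    flipIn (endsD ends d) (OsetH (endsD ends d) ({r, s} : Set V) ρ) (phiO ends r s d ρ) e =
      ρ e := by
  rw [flipOH] at h2
  by_cases hw : e ∈ within (endsD ends d) (OsetH (endsD ends d) ({r, s} : Set V) ρ)
  · rw [flipIn_of_mem hw, h2, flipIn_of_mem hw, Bool.not_not]
  · rw [flipIn_of_notMem hw, h2, flipIn_of_notMem hw]

omit [Fintype V] [Fintype E] [DecidableEq E] in
/-- `phiO` is an involution of the slice colourings. -/
lemma phiO_phiO {r s d : V} {ρ : Config E} (h : StarY ends d ρ) :
    phiO ends r s d (phiO ends r s d ρ) = ρ := by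
  funext e
  by_cases hde : d ∈ ends e
  · by_cases hnd : (ends e).IsDiag
    · -- a loop at `d`: flipped twice by the outside flips, never forced
      have h1 : phiO ends r s d (phiO ends r s d ρ) e =
          flipOH (endsD ends d) ({r, s} : Set V) (phiO ends r s d ρ) e := starForce_of_isDiag hnd
      have h2 : phiO ends r s d ρ e = flipOH (endsD ends d) ({r, s} : Set V) ρ e :=
        starForce_of_isDiag hnd
      rw [h1, flipOH, OsetH_phiO]
      exact flipIn_phiO_eq h2
    · simp only [phiO, starForce, hde, hnd, not_false_eq_true, and_self, if_true]
      exact (h e hde hnd).symm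
  · rw [phiO_eq_off hde, flipOH, OsetH_phiO]
    exact flipIn_phiO_eq (phiO_eq_off hde)

omit [Fintype V] [Fintype E] [DecidableEq E] in
/-- A component assignment of `phiO ρ` agrees with that of the outside flip off the edges at
`d`. -/
lemma assignC_phiO_eq_off {r s d : V} {ρ : Config E} (T : Finset (Finset V)) {e : E}
    (he : d ∉ ends e) :
    assignC (endsD ends d) T (phiO ends r s d ρ) e =
      assignC (endsD ends d) T (flipOH (endsD ends d) ({r, s} : Set V) ρ) e := by
  simp only [assignC, assign, flipTouch, phiO_eq_off he]

omit [Fintype V] [Fintype E] [DecidableEq E] in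
/-- Connections of `G − d` at an assignment of `phiO ρ` are those at the outside flip. -/
lemma conn_assignC_phiO_iff {r s d : V} {ρ : Config E} (T : Finset (Finset V)) {a b : V} :
    Conn (endsD ends d) (assignC (endsD ends d) T (phiO ends r s d ρ)) a b ↔
      Conn (endsD ends d) (assignC (endsD ends d) T (flipOH (endsD ends d) ({r, s} : Set V) ρ))
        a b :=
  conn_endsD_iff_of_eqOn (fun _ he => assignC_phiO_eq_off T he)

omit [Fintype V] [Fintype E] [DecidableEq E] in
/-- `W`-connections of `G − d` at an assignment of `phiO ρ` are those at the outside flip. -/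
lemma conn_compl_assignC_phiO_iff {r s d : V} {ρ : Config E} (T : Finset (Finset V)) {a b : V} :
    Conn (endsD ends d) (OneColourSwitch.compl (assignC (endsD ends d) T (phiO ends r s d ρ)))
        a b ↔
      Conn (endsD ends d) (OneColourSwitch.compl (assignC (endsD ends d) T
        (flipOH (endsD ends d) ({r, s} : Set V) ρ))) a b :=
  conn_endsD_iff_of_eqOn (fun _ he => by
    simp only [OneColourSwitch.compl, assignC_phiO_eq_off T he])

/-- The `rs`-sign of `G − d` at an assignment of `phiO ρ` is that at `ρ`. -/
lemma sigma_rs_assignC_phiO {p q r s d : V} {ρ : Config E}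
    (hρ : ρ ∈ RepH (endsD ends d) p q ({r, s} : Set V)) {T : Finset (Finset V)}
    (hT : T ⊆ compsH (endsD ends d) ({r, s} : Set V) ρ) :
    sigma (endsD ends d) (assignC (endsD ends d) T (phiO ends r s d ρ)) r s =
      sigma (endsD ends d) (assignC (endsD ends d) T ρ) r s := by
  have _ := hρ
  rw [← sigma_rs_assignC_flipOH (Set.mem_insert r _) s hT]
  unfold sigma
  simp only [conn_assignC_phiO_iff T, conn_compl_assignC_phiO_iff T]
  by_cases h1 : Conn (endsD ends d)
      (assignC (endsD ends d) T (flipOH (endsD ends d) ({r, s} : Set V) ρ)) r s <;>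
    by_cases h2 : Conn (endsD ends d) (OneColourSwitch.compl
      (assignC (endsD ends d) T (flipOH (endsD ends d) ({r, s} : Set V) ρ))) r s <;>
    simp [h1, h2]

/-- **The complement identity with `phiO`**: `p ~_W q` at `ρ_T` in `G − d` is `p ~_Y q` at
`(φρ)_{A ∖ T}`, and `p ~_W q` at `(φρ)_T` is `p ~_Y q` at `ρ_{A ∖ T}`. -/
lemma conn_pq_compl_assignC_phiO {p q r s d : V} {ρ : Config E}
    (hρ : ρ ∈ RepH (endsD ends d) p q ({r, s} : Set V)) {T : Finset (Finset V)}
    (hT : T ⊆ compsH (endsD ends d) ({r, s} : Set V) ρ) :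
    (Conn (endsD ends d) (OneColourSwitch.compl (assignC (endsD ends d) T ρ)) p q ↔
      Conn (endsD ends d) (assignC (endsD ends d) (compsH (endsD ends d) ({r, s} : Set V) ρ \ T)
        (phiO ends r s d ρ)) p q) ∧
    (Conn (endsD ends d) (OneColourSwitch.compl (assignC (endsD ends d) T (phiO ends r s d ρ)))
        p q ↔
      Conn (endsD ends d) (assignC (endsD ends d) (compsH (endsD ends d) ({r, s} : Set V) ρ \ T)
        ρ) p q) := by
  have hρO := flipOH_mem_RepH hρ
  have hTO : T ⊆ compsH (endsD ends d) ({r, s} : Set V)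
      (flipOH (endsD ends d) ({r, s} : Set V) ρ) := by rw [compsH_flipOH]; exact hT
  constructor
  · rw [conn_pq_compl_assignC_H hρ hT, conn_assignC_phiO_iff]
  · rw [conn_compl_assignC_phiO_iff, conn_pq_compl_assignC_H hρO hTO, compsH_flipOH,
      flipOH_flipOH]

end Involution

end NoPocket

end Summit.Ventures.PercRepro2
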